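import Summits.BirchSwinnertonDyer.BirchSwinnertonDyer.Theorems.GenusKolyvaginAtTwoShaCardDvdPowAtTwoRTDescentAtTransposition
import Summits.BirchSwinnertonDyer.BirchSwinnertonDyer.Theorems.ByReductionTypeAtTwoRankOneAtTwoBigImageOddLocalOneDoorBottomLemma43AtTwo
import Summits.BirchSwinnertonDyer.BirchSwinnertonDyer.Theorems.GenusKolyvaginAtTwoPowDvdShaCardAtTwoRTLevelCompatibility
import Summits.BirchSwinnertonDyer.BirchSwinnertonDyer.Theorems.GenusKolyvaginAtTwoEquivariantKolyvaginExactAtTwoEigenClassesFinite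
import HarnessLib

/-!
# Route `GenusKolyvaginAtTwo`, crux U_T `ShaCardDvdPowAtTwoRT` (stmt-BirchSwinnertonDyer-23658; upper half
# `#Ш(E/K)[2^∞] ∣ 2^(2M₀)`) — TQ-DEEP ASSEMBLED for the route's Kolyvagin classes: the ℚ-descent (sign `+`: to `E`; sign `−`: to the twin
# `E^{(c)}`, `K = ℚ(√c)`) of the level-`M` Kolyvagin class `c_M(n)` built from MARGIN-ONE primes (index `≥ M + 1`) is SELMER at every finite
# place of `ℚ` off `n` — in particular at the transposition primes `q ∣ d_K`

Seat `bsd-line-gk2-p3` g25 (PROVER seat 3/3, cell `bsd-f1-sign2`), `--supports stmt-BirchSwinnertonDyer-23658` (helper; closes nothing).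
THEOREMS ONLY (no definition, no named fact, no `sorry`): assembly of `…ShaCardDvdPowAtTwoRTDescentAtTransposition` (p743217: the descent step),
`…RTLevelCompatibility` (gk2-p4: McCallum's Lemma 4.6 `ι_* c_M = 2^{M'−M} c_{M'}`), `…EquivariantKolyvaginExactAtTwoEigenClassesFinite` (this
lineage g13: the ℚ-descents of `τ`-eigenclasses, both signs) and `…OneDoorBottomLemma43AtTwo` (Gross 6.2 at `2` on the odd-Tamagawa slice).
BSD is NOT proved by any of this; neither is U_T nor any stub.

WHY (seat memo `Cruxes/ShaCardDvdPowAtTwoRT/Lines/norm-sharp-upper-gk2p3.md` §4, §8).  The ℚ-frame certificate for the bottom layer `Z₀` of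
`Ш(E/K)[2]` (the part invisible to every `K`-side Kolyvagin Cassels–Tate character, `…RTBottomLayerOrthogonal`) pairs `Z₀` with the ℚ-DESCENDED
Kolyvagin classes; its only possible nuisance terms sit at the transposition primes `q ∣ d_K`, and they vanish iff the descended class is Selmer
at `q`.  The one-bit descent (`…ROneBitDescent`) alone gives only `2u` Selmer; one level up the bit is free (Lemma 4.6).  This file proves, with
every input a tree theorem: **for margin-one `n` and either sign, the ℚ-descent of `c_M(n)` exists and is Selmer at every `v` with `n ∉ w ∣ v`.**
Inputs displayed: `E(K)[2^(M+1)] = 0` (`hL`; `ρ̄_{E,2}` onto) and the `τ`-parity of the classes at the two levels (`sign_conjAct_kolyvaginClass_two`: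
`−w(E)·(−1)^{#primes}`, level-independent).
* `exists_descent_kolyvaginClass_two_mem_selmerLocalKer_of_margin` (sign `+`, member `E`);
* `exists_twin_descent_kolyvaginClass_two_mem_selmerLocalKer_of_margin` (sign `−`, twin member `E^{(c)}`).

References: [McCallumLMS1991] §4 Lemma 4.3, Lemma 4.6; [GrossLMS1991] Prop. 5.4, Prop. 6.2; [Kolyvagin1989Izv] §3; [MilneADT2006] I Prop. 3.8.
-/

set_option autoImplicit false
set_option linter.dupNamespace false -- tree convention: `Summit.BirchSwinnertonDyer.BirchSwinnertonDyer.Theorems` (summit = sub-problem)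

noncomputable section

open scoped Classical

namespace Summit.BirchSwinnertonDyer.BirchSwinnertonDyer.Theorems.GenusExact.SelmerDescent

open WeierstrassCurve NumberField IsDedekindDomain Field
open Literature.NumberTheory.EllipticCurves Literature.NumberTheory.EllipticCurves.ModularForms
  Literature.NumberTheory.GaloisRepresentations Literature.NumberTheory.EllipticCurves.KolyvaginCocycle
open Summit.BirchSwinnertonDyer.Rank1Residual.X11b
open Summit.BirchSwinnertonDyer.BirchSwinnertonDyer.Theorems.GenusExact
open Summit.BirchSwinnertonDyer.BirchSwinnertonDyer.Theorems.GenusExact.EigenClassesFinite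
open Summit.BirchSwinnertonDyer.BirchSwinnertonDyer.Theorems.GenusExact.PlusDescent
open Summit.BirchSwinnertonDyer.BirchSwinnertonDyer.Theorems.RankOneAtTwoOneDoor

/-! ## §3 The route's Kolyvagin classes: the ℚ-descent of `c_M(n)` is Selmer off `n` for margin-one primes (sign `+`) -/

/-- **TQ-DEEP FOR THE ROUTE'S KOLYVAGIN CLASSES (sign `+`, assembled).**  Frame: `E/ℚ` globally minimal, `ρ_{E,2^k}` onto for all `k`,
`∏ c_v(E)` odd; `K = ℚ(θ)` imaginary quadratic (`θ² = c`), `d_K ∉ {−3, −4}`, Heegner hypothesis for `N_E`, `E(K)[2^(M+1)] = 0` (`hL`, true for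
`ρ̄_{E,2}` onto); `(Dt, β, ι)`, `n` square-free of Zhang–Kolyvagin primes at `2` of index `≥ M + 1` (MARGIN ONE), a datum `d`; the classes
`c_M(n)`, `c_{M+1}(n)` `τ`-INVARIANT (`τ = σ₀`; by `sign_conjAct_kolyvaginClass_two` this is the parity `−w(E)·(−1)^{#primes} = +1`, the same at
both levels).  Then for every finite place `v` of `ℚ` with `n ∉ w` for all `w ∣ v` (e.g. a transposition prime `q ∣ d_K`): **the ℚ-descent `u_M` of
`c_M(n)` (`res u_M = c_M(n)`) exists and is SELMER at `v`.**  Proof: `ι_* c_M = 2·c_{M+1}` (McCallum Lemma 4.6, `torsionH1OfDvd_kolyvaginClass_pow`),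
`c_{M+1}` Selmer at `w` (Gross 6.2, `kolyvaginClass_two_mem_selmerLocalKer_of_odd_tamagawaProduct`), descents by `…EigenClassesFinite`, then
`mem_selmerLocalKer_of_resTorsion_level`.  So the ℚ-descended margin-one Kolyvagin class contributes NO term at the transposition primes to the
ℚ-reciprocity / Cassels–Tate certificates of the bottom layer of `Ш(E/K)` (memo §4, §8). [cite: McCallumLMS1991, §4 Lemma 4.3, Lemma 4.6]
[cite: GrossLMS1991, Prop. 5.4, Prop. 6.2] [cite: Kolyvagin1989Izv, §3] -/
theorem exists_descent_kolyvaginClass_two_mem_selmerLocalKer_of_margin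
    (W : WeierstrassCurve ℚ) [W.IsElliptic] [W.IsGloballyMinimal] [NeZero (W.conductorNorm ℤ)]
    (hsurj : ∀ k : ℕ, W.HasSurjectiveModNGaloisRep ((2 ^ k : ℕ) : ℤ)) (hodd : Odd W.tamagawaProduct)
    (K : Type) [Field K] [NumberField K] (hK : IsImaginaryQuadratic K) (h2 : Module.finrank ℚ K = 2)
    {θ : K} {c : ℚ} (hθ : θ ∉ Set.range (algebraMap ℚ K)) (hc : θ ^ 2 = algebraMap ℚ K c)
    (hD3 : NumberField.discr K ≠ -3) (hD4 : NumberField.discr K ≠ -4)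
    (hH : SatisfiesHeegnerHypothesis (W.conductorNorm ℤ) K)
    (Dt : ModularParametrizationData W (W.conductorNorm ℤ)) (β : ℤ) (ι : K →+* ℂ) (M : ℕ)
    {n : ℕ} (hn : Squarefree n)
    (hk : ∀ q ∈ n.primeFactors, Zhang2014.IsKolyvaginPrime (W.conductorNorm ℤ) W K 2 q ∧ M + 1 ≤ Zhang2014.kolyvaginIndex W 2 q)
    (d : KolyvaginHeegnerData Dt β ι n)
    (hL : ∀ P : (W.baseChange K).toAffine.Point, ((2 ^ (M + 1) : ℕ) : ℤ) • P = 0 → P = 0)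
    (hfix1 : conjAct W (sigmaQ K h2 hθ hc) ((2 ^ (M + 1) : ℕ) : ℤ) (d.kolyvaginClass Nat.prime_two (M + 1)) =
      d.kolyvaginClass Nat.prime_two (M + 1))
    (hfix0 : conjAct W (sigmaQ K h2 hθ hc) ((2 ^ M : ℕ) : ℤ) (d.kolyvaginClass Nat.prime_two M) = d.kolyvaginClass Nat.prime_two M)
    (v : HeightOneSpectrum (𝓞 ℚ)) (hv : ∀ w : HeightOneSpectrum (𝓞 K), w.asIdeal.LiesOver v.asIdeal → (n : 𝓞 K) ∉ w.asIdeal) :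
    ∃ u : galH1Torsion W ((2 ^ M : ℕ) : ℤ), resTorsion W K ((2 ^ M : ℕ) : ℤ) u = d.kolyvaginClass Nat.prime_two M ∧
      u ∈ selmerLocalKer W (v.adicCompletion ℚ) ((2 ^ M : ℕ) : ℤ) := by
  have hn0 : n ≠ 0 := hn.ne_zero
  have hD : NumberField.discr K < -4 := KolyvaginAssembly.discr_lt_neg_four hK ⟨hD3, hD4⟩
  -- McCallum's standing inputs at level `M + 1`
  have hA1 : IsAdmissible (absoluteGaloisGroup K) d.pointsSubgroup ((2 ^ (M + 1) : ℕ) : ℤ) :=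
    isAdmissible_pointsSubgroup_two_of_heegner d hK hn0 hD4 hH hsurj (M + 1)
  have hPt1 : d.toGeomPoints d.derivedPoint ∈ invPoints (absoluteGaloisGroup K) d.pointsSubgroup ((2 ^ (M + 1) : ℕ) : ℤ) :=
    Prop44.toGeomPoints_derivedPoint_mem_invPoints hK ι hD hH Dt Nat.prime_two hn hk d
  -- Lemma 4.6: `ι_* c_M = 2 • c_{M+1}`
  have hlev := torsionH1OfDvd_kolyvaginClass_pow d Nat.prime_two (Nat.le_succ M) hA1 hPt1
  have h21 : ((2 ^ (M + 1 - M) : ℕ) : ℤ) = 2 := by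
    rw [Nat.add_sub_cancel_left, pow_one]; norm_num
  rw [h21] at hlev
  -- no `2^M`-torsion either
  have hLM : ∀ P : (W.baseChange K).toAffine.Point, ((2 ^ M : ℕ) : ℤ) • P = 0 → P = 0 := fun P hP ↦
    hL P (by rw [pow_succ, Nat.cast_mul, mul_comm, mul_smul, hP, smul_zero])
  -- the ℚ-descents
  obtain ⟨u1, hu1, -⟩ := existsUnique_resTorsion_eq_of_conjAct_eq W K h2 hθ hc ((2 ^ (M + 1) : ℕ) : ℤ) hL hfix1
  obtain ⟨u0, hu0, -⟩ := existsUnique_resTorsion_eq_of_conjAct_eq W K h2 hθ hc ((2 ^ M : ℕ) : ℤ) hLM hfix0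
  have hinj := resTorsion_injective_of_noTorsion W K h2 hθ hc ((2 ^ (M + 1) : ℕ) : ℤ) hL
  -- Gross 6.2 at level `M + 1` over `K`
  have hK' : ∀ (w : HeightOneSpectrum (𝓞 K)) [w.asIdeal.LiesOver v.asIdeal],
      d.kolyvaginClass Nat.prime_two (M + 1) ∈ selmerLocalKer (W.baseChange K) (w.adicCompletion K) ((2 ^ (M + 1) : ℕ) : ℤ) :=
    fun w hw ↦ kolyvaginClass_two_mem_selmerLocalKer_of_odd_tamagawaProduct W hsurj hodd K hK hD3 hD4 hH Dt β ι (M + 1) hn hk d w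
      (hv w hw)
  exact ⟨u0, hu0, mem_selmerLocalKer_of_resTorsion_level W h2 _ hinj hu0 hu1 hlev v hK'⟩

/-- **TQ-DEEP FOR THE ROUTE'S KOLYVAGIN CLASSES (sign `−`, assembled): the twin descent.**  Same frame; the classes `c_M(n)`, `c_{M+1}(n)`
ANTI-invariant under `τ = σ₀` (parity `−w(E)·(−1)^{#primes} = −1`).  Then for every finite place `v` of `ℚ` with `n ∉ w` for all `w ∣ v` (e.g. a
transposition prime `q ∣ d_K = disc ℚ(θ)`, where the twist `E^{(c)}` is ADDITIVE): **the twin ℚ-descent `y_M ∈ H¹(ℚ, E^{(c)}[2^M])` of `c_M(n)`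
(`hPsiKT (res y_M) = c_M(n)`) exists and is SELMER at `v`.** [cite: McCallumLMS1991, §4 Lemma 4.3, Lemma 4.6] [cite: GrossLMS1991, Prop. 5.4, Prop. 6.2]
[cite: Kolyvagin1989Izv, §3] -/
theorem exists_twin_descent_kolyvaginClass_two_mem_selmerLocalKer_of_margin
    (W : WeierstrassCurve ℚ) [W.IsElliptic] [W.IsGloballyMinimal] [NeZero (W.conductorNorm ℤ)]
    (hsurj : ∀ k : ℕ, W.HasSurjectiveModNGaloisRep ((2 ^ k : ℕ) : ℤ)) (hodd : Odd W.tamagawaProduct)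
    (K : Type) [Field K] [NumberField K] (hK : IsImaginaryQuadratic K) (h2 : Module.finrank ℚ K = 2)
    {θ : K} {c : ℚ} (hθ : θ ∉ Set.range (algebraMap ℚ K)) (hc : θ ^ 2 = algebraMap ℚ K c)
    (hD3 : NumberField.discr K ≠ -3) (hD4 : NumberField.discr K ≠ -4)
    (hH : SatisfiesHeegnerHypothesis (W.conductorNorm ℤ) K)
    (Dt : ModularParametrizationData W (W.conductorNorm ℤ)) (β : ℤ) (ι : K →+* ℂ) (M : ℕ)
    {n : ℕ} (hn : Squarefree n)
    (hk : ∀ q ∈ n.primeFactors, Zhang2014.IsKolyvaginPrime (W.conductorNorm ℤ) W K 2 q ∧ M + 1 ≤ Zhang2014.kolyvaginIndex W 2 q)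
    (d : KolyvaginHeegnerData Dt β ι n)
    (hL : ∀ P : (W.baseChange K).toAffine.Point, ((2 ^ (M + 1) : ℕ) : ℤ) • P = 0 → P = 0)
    (hneg1 : conjAct W (sigmaQ K h2 hθ hc) ((2 ^ (M + 1) : ℕ) : ℤ) (d.kolyvaginClass Nat.prime_two (M + 1)) =
      -d.kolyvaginClass Nat.prime_two (M + 1))
    (hneg0 : conjAct W (sigmaQ K h2 hθ hc) ((2 ^ M : ℕ) : ℤ) (d.kolyvaginClass Nat.prime_two M) = -d.kolyvaginClass Nat.prime_two M)
    (v : HeightOneSpectrum (𝓞 ℚ)) (hv : ∀ w : HeightOneSpectrum (𝓞 K), w.asIdeal.LiesOver v.asIdeal → (n : 𝓞 K) ∉ w.asIdeal) :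
    ∃ y : galH1Torsion (W.quadraticTwist c) ((2 ^ M : ℕ) : ℤ),
      hPsiKT W K hθ hc ((2 ^ M : ℕ) : ℤ) (resTorsion (W.quadraticTwist c) K ((2 ^ M : ℕ) : ℤ) y) = d.kolyvaginClass Nat.prime_two M ∧
        y ∈ selmerLocalKer (W.quadraticTwist c) (v.adicCompletion ℚ) ((2 ^ M : ℕ) : ℤ) := by
  have hn0 : n ≠ 0 := hn.ne_zero
  have hD : NumberField.discr K < -4 := KolyvaginAssembly.discr_lt_neg_four hK ⟨hD3, hD4⟩
  have hA1 : IsAdmissible (absoluteGaloisGroup K) d.pointsSubgroup ((2 ^ (M + 1) : ℕ) : ℤ) :=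
    isAdmissible_pointsSubgroup_two_of_heegner d hK hn0 hD4 hH hsurj (M + 1)
  have hPt1 : d.toGeomPoints d.derivedPoint ∈ invPoints (absoluteGaloisGroup K) d.pointsSubgroup ((2 ^ (M + 1) : ℕ) : ℤ) :=
    Prop44.toGeomPoints_derivedPoint_mem_invPoints hK ι hD hH Dt Nat.prime_two hn hk d
  have hlev := torsionH1OfDvd_kolyvaginClass_pow d Nat.prime_two (Nat.le_succ M) hA1 hPt1
  have h21 : ((2 ^ (M + 1 - M) : ℕ) : ℤ) = 2 := by
    rw [Nat.add_sub_cancel_left, pow_one]; norm_num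
  rw [h21] at hlev
  have hLM : ∀ P : (W.baseChange K).toAffine.Point, ((2 ^ M : ℕ) : ℤ) • P = 0 → P = 0 := fun P hP ↦
    hL P (by rw [pow_succ, Nat.cast_mul, mul_comm, mul_smul, hP, smul_zero])
  obtain ⟨y1, hy1, -⟩ := existsUnique_hPsiKT_resTorsion_eq_of_conjAct_eq_neg W K h2 hθ hc ((2 ^ (M + 1) : ℕ) : ℤ) hL hneg1
  obtain ⟨y0, hy0, -⟩ := existsUnique_hPsiKT_resTorsion_eq_of_conjAct_eq_neg W K h2 hθ hc ((2 ^ M : ℕ) : ℤ) hLM hneg0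
  have hinj := resTorsion_twist_injective_of_noTorsion W K h2 hθ hc ((2 ^ (M + 1) : ℕ) : ℤ) hL
  have hK' : ∀ (w : HeightOneSpectrum (𝓞 K)) [w.asIdeal.LiesOver v.asIdeal],
      d.kolyvaginClass Nat.prime_two (M + 1) ∈ selmerLocalKer (W.baseChange K) (w.adicCompletion K) ((2 ^ (M + 1) : ℕ) : ℤ) :=
    fun w hw ↦ kolyvaginClass_two_mem_selmerLocalKer_of_odd_tamagawaProduct W hsurj hodd K hK hD3 hD4 hH Dt β ι (M + 1) hn hk d w
      (hv w hw)
  exact ⟨y0, hy0, mem_selmerLocalKer_twin_of_resTorsion_level W h2 hθ hc _ hinj hy0 hy1 hlev v hK'⟩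

end Summit.BirchSwinnertonDyer.BirchSwinnertonDyer.Theorems.GenusExact.SelmerDescent

end
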